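import Literature.NumberTheory.LFunctions.VinogradovKorobovFromRichert
import Literature.NumberTheory.LFunctions.ZeroDensityNearOne
import Mathlib.Analysis.SpecialFunctions.Pow.Asymptotics
import HarnessLib

/-!
# `ζ′/ζ` and `1/ζ` on and near the line `σ = 1`: unconditional bounds of Vinogradov–Korobov strength (Titchmarsh, Theorem 3.11 with §6.19)

LABEL (line 1): RH-FREE literature — unconditional upper bounds for the logarithmic derivative of
`ζ` and for `1/ζ` on the line `Re s = 1` and in a Vinogradov–Korobov region to its left; no
statement about zeros of `ξ`, no criterion, nothing RH-equivalent.
bears_on: LADDER-RH B-C/B-P (COLUMN 6 DBR: the `σ = 1` bound is the input of Lagarias 2005,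
Lemma 4.1 (2), `Literature.NumberTheory.LFunctions.lagarias2005_lemma_4_1_2`, discharged in the
sibling module `LagariasDifferencedXiSpacingsLogDerivProofs.lean`); the region form is the standard
analytic input of the Vinogradov–Korobov prime number theorem error term; reusable by the `gm`/`rt`
corpora. WHAT THIS IS NOT: nothing in this file bears on the truth of RH.

Topic `Literature/NumberTheory/LFunctions`. Everything here is PROVED; no definition, no named
fact is introduced.

## What is proved

* `Literature.NumberTheory.LFunctions.ZetaLogDerivVK.norm_logDeriv_zeta_one_le_of_richertType` —
  from a Richert-type bound `|ζ(σ+it)| ≤ A|t|^{B(1−σ)^{3/2}}(log|t|)^P` for `|t| ≥ 3`,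
  `1/2 ≤ σ ≤ 1` (`RichertTypeBound A B P` of `VinogradovKorobovFromRichert.lean`, `A ≥ 1`,
  `B, P ≥ 0`): there is `C > 0` with
  `|ζ′/ζ(1 + it)| ≤ C (log|t|)^{2/3} (log log|t|)^{4/3}` for all `|t| ≥ 22`.
* `Literature.NumberTheory.LFunctions.ZetaLogDerivVK.norm_logDeriv_zeta_one_le` — the same bound
  unconditionally, fed by the tree's Richert-type bound
  `Literature.NumberTheory.LFunctions.exists_richertTypeBound_one` (Vinogradov's exponential-sum
  estimate in Ivić's form; standard axioms).

* `Literature.NumberTheory.LFunctions.ZetaLogDerivVK.norm_logDeriv_zeta_le_vk_of_richertType`,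
  `…norm_inv_zeta_le_vk_of_richertType` — **Titchmarsh's Theorem 3.11 as printed, with the data of
  §6.19** (second section of this file): from the same Richert-type bound there are `c > 0`, `C > 0`
  such that for `|t| ≥ 22` and `σ ≥ 1 − c/((log|t|)^{2/3}(log log|t|)^{1/3})`:
  `ζ(σ+it) ≠ 0`, `|ζ′/ζ(σ+it)| ≤ C (log|t|)^{2/3}(log log|t|)^{1/3}` (3.11.1) and
  `|1/ζ(σ+it)| ≤ C (log|t|)^{2/3}(log log|t|)^{1/3}` (3.11.2); unconditionally
  `…zeta_vk_region_bounds`, `…norm_logDeriv_zeta_le_vk`, `…norm_inv_zeta_le_vk`, and on the line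
  `σ = 1` ((3.11.4), (3.11.5)) `…norm_logDeriv_zeta_one_le_oneThird`, `…norm_inv_zeta_one_le`.

The classical literature result is `ζ′/ζ(s) = O((log t)^{2/3}(log log t)^{1/3})` uniformly for
`σ ≥ 1 − A(log t)^{-2/3}(log log t)^{-1/3}` (Titchmarsh, Theorem 3.11 with the data of §6.19); the
exponent `4/3` of `log log|t|` in the first section is what the one-disc form of Landau's argument
below delivers without Theorem 3.11's second step (Lemma γ: Lemma α on the larger disc of radius
`≍ log log t/Y` plus Borel–Carathéodory), which the second section carries out. Either is
`o(log t / log log t)`, which is all that Titchmarsh's Theorem 5.17 (5.17.4)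
`ζ′(1+it)/ζ(1+it) = O(log t/log log t)` (the statement Lagarias cites) asserts.

## The argument of the first section (Landau; Titchmarsh §3.9 Lemma α run inside the Vinogradov–Korobov region)

Fix `|t| ≥ 22`, `ℓ = log|t| ≥ 3`, `λ = log ℓ ≥ 1`, `Y = ℓ^{2/3}λ^{1/3}` (`VKFromRichert.Yv`). The
tree's Landau–Titchmarsh deduction gives `c > 0` (WLOG `c ≤ 1/4`) with `ζ(σ' + it') ≠ 0` for
`|t'| ≥ 21`, `σ' ≥ 1 − c/Y(log|t'|)` (`VKFromRichert.zeta_zeroFree_of_richertType`). Put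
`R' = c/(4Y)`, `d = R'/4` and `c₁ = 1 + d + it`. On the disc `|z − c₁| ≤ 2R'` (inside the disc of
radius `2R`, `R = λ/(16Y) ≥ R'`, of the tree's `VKFromRichert.norm_zeta_le_on_disc`) one has
`|ζ(z)| ≤ M = 2^{P+1}Aℓ^{P+3+B/10} + 42ℓ`, while `|ζ(c₁)| ≥ d/(1+d) ≥ d/2`
(`ZetaClassicalRegion.norm_riemannZeta_ge_of_one_lt_re`). A zero `a` of `ζ` with `|a − c₁| ≤ R'`
would have `Re a ≥ 1 + d − R' = 1 − 3c/(16Y)` and `|Im a − t| ≤ 1/16`, so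
`Y(log|Im a|) ≤ Y(2ℓ) ≤ 2Y` and `Re a ≥ 1 − c/Y(log|Im a|)`: impossible. Hence Titchmarsh's Lemma α
(`Literature.Analysis.Complex.titchmarsh_logDeriv_sub_sum_of_differentiableOn`, radius `R'`) has an
EMPTY zero set, and at `z₀ = 1 + it` (`|z₀ − c₁| = d = R'/4`) it reads
`|ζ′/ζ(1+it)| ≤ 8(log(M/|ζ(c₁)|) + 1)/R' ≤ (32Y/c)(log(32MY/c) + 1) ≤ C ℓ^{2/3} λ^{4/3}`,
since `log(32MY/c) ≤ log(32(2^{P+1}A + 42)/c) + (P + 4 + B/10) λ`.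

## References

* E. C. Titchmarsh, *The Theory of the Riemann Zeta-Function*, 2nd ed. revised by
  D. R. Heath-Brown (1986), §3.9 Lemmas α, β, γ, Theorem 3.10, Theorem 3.11 (3.11.1)–(3.11.8),
  Theorem 5.17 (5.17.4), §6.19. [Titchmarsh1986]
* E. Landau, *Über die Wurzeln der Zetafunktion*, Math. Z. 20 (1924), 98–104.
* J. C. Lagarias, *Zero spacing distributions for differenced L-functions*, Acta Arith. 120 (2005)
  159–184, Lemma 4.1 (2) (the consumer). [Lagarias2005]
-/

noncomputable section

open Complex Filter Topology Metric Set Asymptotics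

namespace Literature.NumberTheory.LFunctions

namespace ZetaLogDerivVK

open VKFromRichert

/-- Monotonicity of `Y(x) = x^{2/3}(log x)^{1/3}` on `[1, ∞)`. [folklore] -/
private theorem Yv_mono {x y : ℝ} (hx : 1 ≤ x) (hxy : x ≤ y) : Yv x ≤ Yv y := by
  unfold Yv
  have hx0 : 0 ≤ x := by linarith
  have hlx : 0 ≤ Real.log x := Real.log_nonneg hx
  have hly : Real.log x ≤ Real.log y := Real.log_le_log (by linarith) hxy
  apply mul_le_mul
  · exact Real.rpow_le_rpow hx0 hxy (by norm_num)
  · exact Real.rpow_le_rpow hlx hly (by norm_num)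
  · exact Real.rpow_nonneg hlx _
  · exact Real.rpow_nonneg (by linarith) _

/-- `Y(2ℓ) ≤ 2Y(ℓ)` for `ℓ ≥ 3` (`log(2ℓ) ≤ 2 log ℓ`). [folklore] -/
private theorem Yv_two_mul_le {ℓ : ℝ} (hℓ : 3 ≤ ℓ) : Yv (2 * ℓ) ≤ 2 * Yv ℓ := by
  unfold Yv
  have hℓ0 : 0 < ℓ := by linarith
  have hlam1 : 1 ≤ Real.log ℓ := one_le_log hℓ
  have hlam0 : 0 ≤ Real.log ℓ := by linarith
  have hlog2 : Real.log 2 ≤ 1 := by have := Real.log_two_lt_d9; linarith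
  have h2l : Real.log (2 * ℓ) ≤ 2 * Real.log ℓ := by
    rw [Real.log_mul (by norm_num) hℓ0.ne']; linarith
  have h1 : (2 * ℓ) ^ (2 / 3 : ℝ) = 2 ^ (2 / 3 : ℝ) * ℓ ^ (2 / 3 : ℝ) :=
    Real.mul_rpow (by norm_num) hℓ0.le
  have h2 : Real.log (2 * ℓ) ^ (1 / 3 : ℝ) ≤ (2 * Real.log ℓ) ^ (1 / 3 : ℝ) :=
    Real.rpow_le_rpow (Real.log_nonneg (by linarith)) h2l (by norm_num)
  have h3 : (2 * Real.log ℓ) ^ (1 / 3 : ℝ) = 2 ^ (1 / 3 : ℝ) * Real.log ℓ ^ (1 / 3 : ℝ) :=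
    Real.mul_rpow (by norm_num) hlam0
  have h22 : (2 : ℝ) ^ (2 / 3 : ℝ) * 2 ^ (1 / 3 : ℝ) = 2 := by
    rw [← Real.rpow_add (by norm_num)]; norm_num
  have h4 : 0 ≤ (2 : ℝ) ^ (2 / 3 : ℝ) * ℓ ^ (2 / 3 : ℝ) := by positivity
  calc (2 * ℓ) ^ (2 / 3 : ℝ) * Real.log (2 * ℓ) ^ (1 / 3 : ℝ)
      ≤ (2 ^ (2 / 3 : ℝ) * ℓ ^ (2 / 3 : ℝ)) * (2 ^ (1 / 3 : ℝ) * Real.log ℓ ^ (1 / 3 : ℝ)) := by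
        rw [h1]
        exact mul_le_mul_of_nonneg_left (h2.trans h3.le) h4
    _ = (2 ^ (2 / 3 : ℝ) * 2 ^ (1 / 3 : ℝ)) * (ℓ ^ (2 / 3 : ℝ) * Real.log ℓ ^ (1 / 3 : ℝ)) := by
        ring
    _ = 2 * (ℓ ^ (2 / 3 : ℝ) * Real.log ℓ ^ (1 / 3 : ℝ)) := by rw [h22]

/-- **No zero of `ζ` near `1 + it` (Vinogradov–Korobov).** If `ζ ≠ 0` on
`σ ≥ 1 − c₀/Y(log|t'|)`, `|t'| ≥ 21` (`Y(x) = x^{2/3}(log x)^{1/3}`), `0 < c ≤ c₀` and `|t| ≥ 22`, then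
`ζ(a) ≠ 0` whenever `|Im a − t| ≤ 1` and `Re a ≥ 1 − 3c/(16 Y(log|t|))`
(because `Y(log|Im a|) ≤ Y(2 log|t|) ≤ 2Y(log|t|)`). [folklore] -/
private theorem zeta_ne_zero_of_zeroFree {c₀ c : ℝ} (hc0 : 0 < c) (hcc₀ : c ≤ c₀)
    (hzf : ∀ s : ℂ, 21 ≤ |s.im| →
      1 - c₀ / (Real.log |s.im| ^ (2 / 3 : ℝ) * Real.log (Real.log |s.im|) ^ (1 / 3 : ℝ)) ≤ s.re →
        riemannZeta s ≠ 0)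
    {t : ℝ} (ht : 22 ≤ |t|) {a : ℂ} (him : |a.im - t| ≤ 1)
    (hre : 1 - 3 * c / (16 * Yv (Real.log |t|)) ≤ a.re) : riemannZeta a ≠ 0 := by
  have ht0 : 0 < |t| := by linarith
  have hℓ : 3 ≤ Real.log |t| := three_le_log_of_ge (by linarith)
  obtain ⟨hY0, -, -, -⟩ := Yv_facts hℓ
  have haim21 : 21 ≤ |a.im| := by
    have h2 : |t| - |a.im| ≤ |a.im - t| := by
      rw [abs_sub_comm]; exact abs_sub_abs_le_abs_sub t a.im
    linarith
  have haim2 : |a.im| ≤ 2 * |t| := by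
    have h2 : |a.im| - |t| ≤ |a.im - t| := abs_sub_abs_le_abs_sub a.im t
    linarith
  have haim0 : 0 < |a.im| := by linarith
  have hℓa3 : 3 ≤ Real.log |a.im| := three_le_log_of_ge haim21
  have hℓa2 : Real.log |a.im| ≤ 2 * Real.log |t| := by
    have hlog2 : Real.log 2 ≤ 1 := by have := Real.log_two_lt_d9; linarith
    calc Real.log |a.im| ≤ Real.log (2 * |t|) := Real.log_le_log haim0 haim2
      _ = Real.log 2 + Real.log |t| := by rw [Real.log_mul (by norm_num) ht0.ne']
      _ ≤ 2 * Real.log |t| := by linarith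
  have hYa : Yv (Real.log |a.im|) ≤ 2 * Yv (Real.log |t|) :=
    (Yv_mono (by linarith) hℓa2).trans (Yv_two_mul_le hℓ)
  have hYa0 : 0 < Yv (Real.log |a.im|) := (Yv_facts hℓa3).1
  refine hzf a haim21 ?_
  change 1 - c₀ / Yv (Real.log |a.im|) ≤ a.re
  have h1 : c / Yv (Real.log |a.im|) ≤ c₀ / Yv (Real.log |a.im|) :=
    div_le_div_of_nonneg_right hcc₀ hYa0.le
  have hcY : 0 ≤ c / Yv (Real.log |t|) := by positivity
  have h2 : 3 * c / (16 * Yv (Real.log |t|)) ≤ c / (2 * Yv (Real.log |t|)) := by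
    have e1 : 3 * c / (16 * Yv (Real.log |t|)) = (3 / 16) * (c / Yv (Real.log |t|)) := by ring
    have e2 : c / (2 * Yv (Real.log |t|)) = (1 / 2) * (c / Yv (Real.log |t|)) := by ring
    rw [e1, e2]; linarith
  have h3 : c / (2 * Yv (Real.log |t|)) ≤ c / Yv (Real.log |a.im|) :=
    div_le_div_of_nonneg_left hc0.le hYa0 hYa
  linarith

/-- **`ζ′/ζ` on `σ = 1` from a Richert-type bound** (Landau's method: Titchmarsh §3.9 Lemma α on a
disc inside the Vinogradov–Korobov zero-free region of Theorem 3.10/§6.19): if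
`|ζ(σ+it)| ≤ A|t|^{B(1−σ)^{3/2}}(log|t|)^P` for `|t| ≥ 3`, `1/2 ≤ σ ≤ 1` (`A ≥ 1`, `B, P ≥ 0`), then
there is `C > 0` with `|ζ′(1+it)/ζ(1+it)| ≤ C (log|t|)^{2/3} (log log|t|)^{4/3}` for `|t| ≥ 22`.
(The printed Theorem 3.11 has `(log log t)^{1/3}`; see the module docstring.)
[cite: Titchmarsh1986, §3.9 Lemma α, Theorem 3.11 and §6.19] -/
theorem norm_logDeriv_zeta_one_le_of_richertType {A B P : ℝ} (hRζ : RichertTypeBound A B P)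
    (hA : 1 ≤ A) (hB : 0 ≤ B) (hP : 0 ≤ P) :
    ∃ C : ℝ, 0 < C ∧ ∀ t : ℝ, 22 ≤ |t| →
      ‖deriv riemannZeta (1 + t * I) / riemannZeta (1 + t * I)‖ ≤
        C * Real.log |t| ^ (2 / 3 : ℝ) * Real.log (Real.log |t|) ^ (4 / 3 : ℝ) := by
  obtain ⟨c₀, hc₀, hzf⟩ := zeta_zeroFree_of_richertType hRζ hP
  set c : ℝ := min c₀ (1 / 4) with hcdef
  have hc0 : 0 < c := lt_min hc₀ (by norm_num)
  have hc4 : c ≤ 1 / 4 := min_le_right _ _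
  have hcc₀ : c ≤ c₀ := min_le_left _ _
  have hA0 : 0 < A := by linarith
  -- the exponent `p` of `ℓ` in `M` and the logarithmic constant
  set p : ℝ := P + 3 + B / 10 with hpdef
  have hp3 : 3 ≤ p := by rw [hpdef]; linarith
  have h2P : 0 < (2 : ℝ) ^ (P + 1) := Real.rpow_pos_of_pos (by norm_num) _
  set K : ℝ := 2 ^ (P + 1) * A + 42 with hKdef
  have h2PA : 0 < (2 : ℝ) ^ (P + 1) * A := mul_pos h2P hA0
  have hK0 : 0 < K := by rw [hKdef]; linarith
  have hK42 : 42 ≤ K := by rw [hKdef]; linarith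
  set K₁ : ℝ := Real.log (32 * K / c) with hK₁def
  have hK₁0 : 0 ≤ K₁ := by
    apply Real.log_nonneg
    rw [le_div_iff₀ hc0]
    linarith
  refine ⟨32 / c * (K₁ + p + 2), by positivity, fun t ht ↦ ?_⟩
  -- the parameters at height `t`
  have ht21 : 21 ≤ |t| := by linarith
  have ht4 : 4 ≤ |t| := by linarith
  have ht0 : 0 < |t| := by linarith
  set ℓ : ℝ := Real.log |t| with hℓdef
  have hℓ : 3 ≤ ℓ := three_le_log_of_ge ht21
  have hℓ0 : 0 < ℓ := by linarith
  have hℓ1 : 1 ≤ ℓ := by linarith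
  obtain ⟨hY0, hlamY, hYℓ, -⟩ := Yv_facts hℓ
  set Y : ℝ := Yv ℓ with hYdef
  set lam : ℝ := Real.log ℓ with hlamdef
  have hlam1 : 1 ≤ lam := one_le_log hℓ
  have hlam0 : 0 < lam := by linarith
  obtain ⟨hR0, hR16, -, -⟩ := Rr_facts hℓ le_rfl hℓ0.le
  have hRr : Rr ℓ 0 = lam / (16 * Y) := by
    simp only [Rr, calL, hYdef, hlamdef, zero_add]
  set R' : ℝ := c / (4 * Y) with hR'def
  have hR'0 : 0 < R' := by positivity
  have hR'R : R' ≤ Rr ℓ 0 := by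
    have h1 : c ≤ lam / 4 := by linarith
    calc R' = c / (4 * Y) := hR'def
      _ ≤ (lam / 4) / (4 * Y) := div_le_div_of_nonneg_right h1 (by positivity)
      _ = lam / (16 * Y) := by ring
      _ = Rr ℓ 0 := hRr.symm
  have hR'16 : R' ≤ 1 / 16 := hR'R.trans hR16
  set d : ℝ := R' / 4 with hddef
  have hd0 : 0 < d := by positivity
  have hdR' : d ≤ R' := by rw [hddef]; linarith
  have hdR : d ≤ Rr ℓ 0 := hdR'.trans hR'R
  have hd1 : d ≤ 1 := by linarith
  have hd_eq : d = c / (16 * Y) := by rw [hddef, hR'def]; ring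
  set c₁ : ℂ := ((1 + d : ℝ) : ℂ) + t * I with hc₁def
  have hc₁re : c₁.re = 1 + d := by simp [hc₁def]
  have hc₁im : c₁.im = t := by simp [hc₁def]
  have hc₁1 : 1 < c₁.re := by rw [hc₁re]; linarith
  -- `|ζ| ≤ M` on `|z − c₁| ≤ 2R'` (a sub-disc of the tree's disc of radius `2R`)
  have htℓ : Real.log |t| ≤ ℓ + 1 := by rw [hℓdef]; linarith
  have hMdisc := norm_zeta_le_on_disc hRζ hA hB hP hℓ le_rfl hℓ0.le ht4 htℓ hd0 hdR
  set M : ℝ := Mm A B P ℓ with hMdef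
  have hℓp0 : 0 < ℓ ^ p := Real.rpow_pos_of_pos hℓ0 _
  have hMeq : M = 2 ^ (P + 1) * A * ℓ ^ p + 42 * ℓ := by
    simp only [hMdef, Mm, hpdef]
  have hM0 : 0 < M := by
    rw [hMeq]
    have : 0 < 2 ^ (P + 1) * A * ℓ ^ p := mul_pos h2PA hℓp0
    linarith
  have hM' : ∀ z ∈ closedBall c₁ (2 * R'), ‖riemannZeta z‖ ≤ M := fun z hz ↦
    hMdisc z (closedBall_subset_closedBall (by linarith) hz)
  -- Lemma α on the disc of radius `R'`
  have hdiff : DifferentiableOn ℂ riemannZeta (ball c₁ (1 / 4)) :=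
    differentiableOn_zeta_ball (by rw [hc₁im]; linarith)
  have hζc₁ : riemannZeta c₁ ≠ 0 := riemannZeta_ne_zero_of_one_le_re hc₁1.le
  obtain ⟨S, m, ψ, hS, -, -, hψ, hψb, -⟩ :=
    Literature.Analysis.Complex.titchmarsh_logDeriv_sub_sum_of_differentiableOn hdiff
      (by linarith : 3 * R' < 1 / 4) hζc₁ hR'0 hM'
  -- the Vinogradov–Korobov region: no zero of `ζ` within `R'` of `c₁`
  have hSempty : S = ∅ := by
    refine Finset.eq_empty_of_forall_notMem fun a ha ↦ ?_
    obtain ⟨ha0, -, haR⟩ := hS a ha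
    have him : |a.im - t| ≤ 1 := by
      have h := (Complex.abs_im_le_norm (a - c₁)).trans haR
      rw [Complex.sub_im, hc₁im] at h
      linarith
    have hre : 1 - 3 * c / (16 * Yv (Real.log |t|)) ≤ a.re := by
      have h := (Complex.abs_re_le_norm (a - c₁)).trans haR
      rw [Complex.sub_re, hc₁re, abs_le] at h
      have h3 : 1 + d - R' = 1 - 3 * c / (16 * Y) := by
        rw [hddef, hR'def]; ring
      rw [← hℓdef, ← hYdef]
      linarith [h.1]
    exact zeta_ne_zero_of_zeroFree hc0 hcc₀ hzf ht him hre ha0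
  -- Lemma α at `z₀ = 1 + it`
  set z₀ : ℂ := 1 + t * I with hz₀def
  have hz₀c₁ : z₀ - c₁ = -((d : ℝ) : ℂ) := by
    rw [hz₀def, hc₁def]; push_cast; ring
  have hnorm : ‖z₀ - c₁‖ = d := by
    rw [hz₀c₁, norm_neg, Complex.norm_real, Real.norm_eq_abs, abs_of_pos hd0]
  have hz₀ball : z₀ ∈ ball c₁ R' := by
    rw [mem_ball, dist_eq_norm, hnorm, hddef]; linarith
  have hz₀cb : z₀ ∈ closedBall c₁ (R' / 4) := by
    rw [mem_closedBall, dist_eq_norm, hnorm]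
  have hz₀re : z₀.re = 1 := by simp [hz₀def]
  have hζz₀ : riemannZeta z₀ ≠ 0 := riemannZeta_ne_zero_of_one_le_re hz₀re.symm.le
  have hψz₀ := hψ z₀ hz₀ball hζz₀
  rw [hSempty, Finset.sum_empty, sub_zero] at hψz₀
  have hbound := hψb z₀ hz₀cb
  rw [hψz₀] at hbound
  -- `|ζ(c₁)| ≥ d/2`
  have hζlow : d / 2 ≤ ‖riemannZeta c₁‖ := by
    have h := ZetaClassicalRegion.norm_riemannZeta_ge_of_one_lt_re hc₁1
    rw [hc₁re] at h
    have e : (1 + d - 1) / (1 + d) = d / (1 + d) := by ring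
    rw [e] at h
    have : d / 2 ≤ d / (1 + d) := div_le_div_of_nonneg_left hd0.le (by linarith) (by linarith)
    exact this.trans h
  have hζpos : 0 < ‖riemannZeta c₁‖ := lt_of_lt_of_le (by positivity) hζlow
  have hlog1 : Real.log (M / ‖riemannZeta c₁‖) ≤ Real.log (2 * M / d) := by
    refine Real.log_le_log (div_pos hM0 hζpos) ?_
    calc M / ‖riemannZeta c₁‖ ≤ M / (d / 2) := div_le_div_of_nonneg_left hM0.le (by positivity) hζlow
      _ = 2 * M / d := by rw [div_div_eq_mul_div]; ring
  -- `log(2M/d) ≤ K₁ + (p+1) λ`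
  have hMle : M ≤ K * ℓ ^ p := by
    have hℓp1 : ℓ ≤ ℓ ^ p := by
      calc ℓ = ℓ ^ (1 : ℝ) := (Real.rpow_one ℓ).symm
        _ ≤ ℓ ^ p := Real.rpow_le_rpow_of_exponent_le hℓ1 (by linarith)
    have h42 : 42 * ℓ ≤ 42 * ℓ ^ p := by linarith
    rw [hMeq, hKdef, add_mul]
    linarith
  have hquot : 2 * M / d = 32 / c * (M * Y) := by
    rw [hd_eq]; field_simp; ring
  have h2Md : 2 * M / d ≤ 32 * K / c * ℓ ^ (p + 1) := by
    have hMY : M * Y ≤ (K * ℓ ^ p) * ℓ := mul_le_mul hMle hYℓ hY0.le (by positivity)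
    rw [hquot, Real.rpow_add hℓ0, Real.rpow_one]
    calc 32 / c * (M * Y) ≤ 32 / c * ((K * ℓ ^ p) * ℓ) :=
          mul_le_mul_of_nonneg_left hMY (by positivity)
      _ = 32 * K / c * (ℓ ^ p * ℓ) := by ring
  have hlog2 : Real.log (2 * M / d) ≤ K₁ + (p + 1) * lam := by
    have hpos : 0 < 2 * M / d := by positivity
    have hne1 : (32 * K / c : ℝ) ≠ 0 := (by positivity : (0 : ℝ) < 32 * K / c).ne'
    have hne2 : (ℓ ^ (p + 1) : ℝ) ≠ 0 := (Real.rpow_pos_of_pos hℓ0 _).ne'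
    calc Real.log (2 * M / d) ≤ Real.log (32 * K / c * ℓ ^ (p + 1)) :=
          Real.log_le_log hpos h2Md
      _ = K₁ + (p + 1) * lam := by
          rw [Real.log_mul hne1 hne2, Real.log_rpow hℓ0, hK₁def, hlamdef]
  -- assembly
  have h81 : 8 * (Real.log (M / ‖riemannZeta c₁‖) + 1) / R' ≤
      32 / c * (K₁ + p + 2) * Y * lam := by
    have hnum : Real.log (M / ‖riemannZeta c₁‖) + 1 ≤ (K₁ + p + 2) * lam := by
      have hK₁lam : K₁ * 1 ≤ K₁ * lam := mul_le_mul_of_nonneg_left hlam1 hK₁0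
      have e : (K₁ + p + 2) * lam = K₁ * lam + (p + 1) * lam + lam := by ring
      rw [e]
      linarith
    have hR'inv : 8 / R' = 32 / c * Y := by rw [hR'def]; field_simp; ring
    calc 8 * (Real.log (M / ‖riemannZeta c₁‖) + 1) / R'
        = 8 / R' * (Real.log (M / ‖riemannZeta c₁‖) + 1) := by ring
      _ ≤ 8 / R' * ((K₁ + p + 2) * lam) :=
          mul_le_mul_of_nonneg_left hnum (by positivity)
      _ = 32 / c * (K₁ + p + 2) * Y * lam := by rw [hR'inv]; ring
  have hYlam : Y * lam = ℓ ^ (2 / 3 : ℝ) * lam ^ (4 / 3 : ℝ) := by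
    have e : lam ^ (4 / 3 : ℝ) = lam ^ (1 / 3 : ℝ) * lam := by
      rw [show (4 / 3 : ℝ) = 1 / 3 + 1 by norm_num, Real.rpow_add_one hlam0.ne']
    rw [e, hYdef, Yv, ← hlamdef]; ring
  calc ‖deriv riemannZeta z₀ / riemannZeta z₀‖
      ≤ 8 * (Real.log (M / ‖riemannZeta c₁‖) + 1) / R' := hbound
    _ ≤ 32 / c * (K₁ + p + 2) * Y * lam := h81
    _ = 32 / c * (K₁ + p + 2) * (Y * lam) := by ring
    _ = 32 / c * (K₁ + p + 2) * ℓ ^ (2 / 3 : ℝ) * lam ^ (4 / 3 : ℝ) := by rw [hYlam]; ring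

/-- **`ζ′(1+it)/ζ(1+it) ≪ (log|t|)^{2/3}(log log|t|)^{4/3}`, unconditionally** (`|t| ≥ 22`): the
previous theorem fed with the tree's Richert-type bound
`Literature.NumberTheory.LFunctions.exists_richertTypeBound_one` (Vinogradov's exponential-sum
estimate in Ivić's form, `P = 1`). In particular `ζ′/ζ(1+it) = o(log t/log log t)`, the content of
Titchmarsh's (5.17.4). [cite: Titchmarsh1986, Theorem 3.11, Theorem 5.17 (5.17.4) and §6.19] -/
theorem norm_logDeriv_zeta_one_le :
    ∃ C : ℝ, 0 < C ∧ ∀ t : ℝ, 22 ≤ |t| →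
      ‖deriv riemannZeta (1 + t * I) / riemannZeta (1 + t * I)‖ ≤
        C * Real.log |t| ^ (2 / 3 : ℝ) * Real.log (Real.log |t|) ^ (4 / 3 : ℝ) := by
  obtain ⟨A, B, hA, hB, hR⟩ := exists_richertTypeBound_one
  exact norm_logDeriv_zeta_one_le_of_richertType hR hA hB (by norm_num)

/-- **Titchmarsh's (5.17.4) in little-`o` form: `ζ′(1+it)/ζ(1+it) = o(log t / log log t)` as
`t → +∞`** (the printed statement is `O(log t/log log t)` for `t > A`; here from
`≪ (log t)^{2/3}(log log t)^{4/3}` and `(log log t)^{7/3} = o((log t)^{1/3})`, Mathlib's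
`isLittleO_log_rpow_rpow_atTop`). [cite: Titchmarsh1986, Theorem 5.17 (5.17.4)] -/
theorem isLittleO_logDeriv_zeta_one :
    (fun t : ℝ ↦ deriv riemannZeta (1 + t * I) / riemannZeta (1 + t * I)) =o[atTop]
      fun t : ℝ ↦ Real.log t / Real.log (Real.log t) := by
  obtain ⟨C, hC, hb⟩ := norm_logDeriv_zeta_one_le
  refine Asymptotics.isLittleO_iff.2 fun ε hε ↦ ?_
  have hεC : 0 < ε / C := div_pos hε hC
  have h := ((isLittleO_log_rpow_rpow_atTop (7 / 3 : ℝ) (by norm_num : (0 : ℝ) < 1 / 3)).comp_tendsto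
    Real.tendsto_log_atTop).def hεC
  filter_upwards [h, eventually_ge_atTop (22 : ℝ)] with t ht ht22
  have ht0 : 0 < t := by linarith
  have hℓ3 : 3 ≤ Real.log t := three_le_log_of_ge (by linarith)
  have hℓ0 : 0 < Real.log t := by linarith
  have hlam1 : 1 ≤ Real.log (Real.log t) := one_le_log hℓ3
  have hlam0 : 0 < Real.log (Real.log t) := by linarith
  simp only [Function.comp, Real.norm_eq_abs] at ht
  rw [abs_of_nonneg (Real.rpow_nonneg hlam0.le _), abs_of_nonneg (Real.rpow_nonneg hℓ0.le _)] at ht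
  have hmain := hb t (by rwa [abs_of_pos ht0])
  rw [abs_of_pos ht0] at hmain
  rw [Real.norm_eq_abs, abs_of_pos (div_pos hℓ0 hlam0)]
  have e1 : Real.log (Real.log t) ^ (4 / 3 : ℝ) =
      Real.log (Real.log t) ^ (7 / 3 : ℝ) / Real.log (Real.log t) := by
    rw [eq_div_iff hlam0.ne', ← Real.rpow_add_one hlam0.ne']; norm_num
  have e2 : Real.log t ^ (2 / 3 : ℝ) * Real.log t ^ (1 / 3 : ℝ) = Real.log t := by
    rw [← Real.rpow_add hℓ0]; norm_num
  calc ‖deriv riemannZeta (1 + t * I) / riemannZeta (1 + t * I)‖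
      ≤ C * Real.log t ^ (2 / 3 : ℝ) * Real.log (Real.log t) ^ (4 / 3 : ℝ) := hmain
    _ = C * Real.log t ^ (2 / 3 : ℝ) * Real.log (Real.log t) ^ (7 / 3 : ℝ) /
          Real.log (Real.log t) := by rw [e1]; ring
    _ ≤ C * Real.log t ^ (2 / 3 : ℝ) * (ε / C * Real.log t ^ (1 / 3 : ℝ)) /
          Real.log (Real.log t) := by gcongr
    _ = ε * (Real.log t ^ (2 / 3 : ℝ) * Real.log t ^ (1 / 3 : ℝ)) / Real.log (Real.log t) := by
          field_simp
    _ = ε * (Real.log t / Real.log (Real.log t)) := by rw [e2, mul_div_assoc]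

/-- **Titchmarsh's (5.17.4) as printed: `ζ′(1+it)/ζ(1+it) = O(log t / log log t)`** (`t → +∞`).
[cite: Titchmarsh1986, Theorem 5.17 (5.17.4)] -/
theorem isBigO_logDeriv_zeta_one :
    (fun t : ℝ ↦ deriv riemannZeta (1 + t * I) / riemannZeta (1 + t * I)) =O[atTop]
      fun t : ℝ ↦ Real.log t / Real.log (Real.log t) :=
  isLittleO_logDeriv_zeta_one.isBigO


/-! ## Titchmarsh's Theorem 3.11 in the Vinogradov–Korobov region (the printed exponent `1/3`)

The printed road (Titchmarsh §3.11, via §3.9 Lemma γ): Lemma α on the LARGE disc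
`|z − c₁| ≤ R`, `R = λ/(16Y)` (the disc of `VKFromRichert.norm_zeta_le_on_disc`, on which
`log|ζ| ≤ log M ≍ λ`), so that the Lemma-α error `8(log(M/|ζ(c₁)|) + 1)/R ≍ λ · Y/λ = Y`; the
zeros `a` of the Lemma-α sum all lie to the left of the Vinogradov–Korobov line
`Re a < 1 − w`, `w = 3c/(16Y)`, hence `−Re ζ′/ζ ≤ E₀ ≍ Y` on the part `Re z > 1 − w` of the small
disc `|z − c₁| < 2w` (`c₁ = 1 + w + it`); Borel–Carathéodory on that disc (Mathlib's
`Complex.borelCaratheodory`) and `|ζ′/ζ(c₁)| ≤ 1/w + K₀` give `|ζ′/ζ(σ + it)| ≪ Y` for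
`σ ≥ 1 − w/2`; `1/ζ ≪ Y` follows by integrating `ζ′/ζ` along `[σ, 1 + 1/(8Y)] + it` (here, as in
`ZetaClassicalRegion.norm_inv_le_of_three_le`, by Grönwall's inequality).
-/

/-- **Borel–Carathéodory at a general centre** (Mathlib's `Complex.borelCaratheodory`, translated
from the origin to `c`): `f` holomorphic on `‖w − c‖ < ρ` with `Re f ≤ E` there (`E > 0`); then
`‖f(z)‖ ≤ 2E‖z − c‖/(ρ − ‖z − c‖) + ‖f(c)‖(ρ + ‖z − c‖)/(ρ − ‖z − c‖)` for `‖z − c‖ < ρ`.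
[cite: Titchmarsh1986, §3.9 (proof of Lemma α, Borel–Carathéodory)] -/
theorem borelCaratheodory_of_centre {f : ℂ → ℂ} {c z : ℂ} {E ρ : ℝ} (hE : 0 < E) (hρ : 0 < ρ)
    (hf : DifferentiableOn ℂ f (ball c ρ)) (hre : ∀ w ∈ ball c ρ, (f w).re ≤ E)
    (hz : z ∈ ball c ρ) :
    ‖f z‖ ≤ 2 * E * ‖z - c‖ / (ρ - ‖z - c‖) + ‖f c‖ * (ρ + ‖z - c‖) / (ρ - ‖z - c‖) := by
  set g : ℂ → ℂ := fun w ↦ f (c + w) with hg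
  have hmaps : MapsTo (fun w : ℂ ↦ c + w) (ball 0 ρ) (ball c ρ) := by
    intro w hw
    simpa [mem_ball, dist_eq_norm] using hw
  have hgd : DifferentiableOn ℂ g (ball 0 ρ) :=
    hf.comp ((differentiableOn_const c).add differentiableOn_id) hmaps
  have hgre : MapsTo g (ball 0 ρ) {w | w.re ≤ E} := fun w hw ↦ hre _ (hmaps hw)
  have hz' : z - c ∈ ball (0 : ℂ) ρ := by
    simpa [mem_ball, dist_eq_norm] using hz
  have h := Complex.borelCaratheodory hE hgd hgre hρ hz'
  have e1 : g (z - c) = f z := by simp [hg]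
  have e2 : g 0 = f c := by simp [hg]
  rw [e1, e2] at h
  exact h

/-- **`|ζ′/ζ(s)| ≤ 1/(min σ 2 − 1) + K₀` for `σ > 1`** (`|ζ′/ζ(s)| ≤ −ζ′/ζ(σ) ≤ 1/(σ−1) + O(1)`;
the tree's `DirichletZFR.exists_norm_logDeriv_le` at the trivial character mod `1`, whose
`L`-function is `ζ`). [cite: MontgomeryVaughan2007, p. 277 (proof of Theorem 11.4)] -/
theorem exists_norm_logDeriv_zeta_le_right :
    ∃ K₀ : ℝ, 0 ≤ K₀ ∧ ∀ s : ℂ, 1 < s.re →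
      ‖deriv riemannZeta s / riemannZeta s‖ ≤ 1 / (min s.re 2 - 1) + K₀ := by
  obtain ⟨K₀, hK₀, -, hK⟩ := DirichletZFR.exists_norm_logDeriv_le
  refine ⟨K₀, hK₀, fun s hs ↦ ?_⟩
  have h := hK 1 (1 : DirichletCharacter ℂ 1) s hs
  rwa [DirichletCharacter.LFunction_modOne_eq] at h

/-- **Titchmarsh's Theorem 3.11, (3.11.1), at Vinogradov–Korobov strength, from a Richert-type
bound** (Theorem 3.11 with the data of §6.19: `θ(t) = (log log t/log t)^{2/3}`,
`φ(t) ≍ log log t`, `φ/θ = (log t)^{2/3}(log log t)^{1/3}`). If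
`|ζ(σ+it)| ≤ A|t|^{B(1−σ)^{3/2}}(log|t|)^P` for `|t| ≥ 3`, `1/2 ≤ σ ≤ 1` (`A ≥ 1`, `B, P ≥ 0`), then
there are `c > 0` and `C > 0` such that for every `s = σ + it` with `|t| ≥ 22` and
`σ ≥ 1 − c/((log|t|)^{2/3}(log log|t|)^{1/3})`: `ζ(s) ≠ 0` and
`|ζ′(s)/ζ(s)| ≤ C (log|t|)^{2/3}(log log|t|)^{1/3}`. Printed: "Under the hypotheses of Theorem 3.10
we have `ζ′(s)/ζ(s) = O{φ(2t+3)/θ(2t+3)}` … uniformly for `σ ≥ 1 − (A₁/4)θ(2t+3)/φ(2t+3)`."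
Proof by Lemma γ of §3.9 (Lemma α on the disc of radius `R = log log|t|/(16Y)`, positivity of the
zero terms to the right of the zero-free line of Theorem 3.10/§6.19
(`VKFromRichert.zeta_zeroFree_of_richertType`), Borel–Carathéodory); see the section docstring.
[cite: Titchmarsh1986, Theorem 3.11 eq. (3.11.1), §3.9 Lemma γ and §6.19] -/
theorem norm_logDeriv_zeta_le_vk_of_richertType {A B P : ℝ} (hRζ : RichertTypeBound A B P)
    (hA : 1 ≤ A) (hB : 0 ≤ B) (hP : 0 ≤ P) :
    ∃ c : ℝ, 0 < c ∧ ∃ C : ℝ, 0 < C ∧ ∀ s : ℂ, 22 ≤ |s.im| →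
      1 - c / (Real.log |s.im| ^ (2 / 3 : ℝ) * Real.log (Real.log |s.im|) ^ (1 / 3 : ℝ)) ≤ s.re →
        riemannZeta s ≠ 0 ∧
        ‖deriv riemannZeta s / riemannZeta s‖ ≤
          C * Real.log |s.im| ^ (2 / 3 : ℝ) * Real.log (Real.log |s.im|) ^ (1 / 3 : ℝ) := by
  obtain ⟨c₀, hc₀, hzf⟩ := zeta_zeroFree_of_richertType hRζ hP
  obtain ⟨K₀, hK₀, hKζ⟩ := exists_norm_logDeriv_zeta_le_right
  set c : ℝ := min c₀ (1 / 24) with hcdef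
  have hc0 : 0 < c := lt_min hc₀ (by norm_num)
  have hc24 : c ≤ 1 / 24 := min_le_right _ _
  have hcc₀ : c ≤ c₀ := min_le_left _ _
  have hA0 : 0 < A := by linarith
  -- the exponent `p` of `ℓ` in `M` and the logarithmic constant
  set p : ℝ := P + 3 + B / 10 with hpdef
  have hp3 : 3 ≤ p := by rw [hpdef]; linarith
  have h2P : 0 < (2 : ℝ) ^ (P + 1) := Real.rpow_pos_of_pos (by norm_num) _
  set K : ℝ := 2 ^ (P + 1) * A + 42 with hKdef
  have h2PA : 0 < (2 : ℝ) ^ (P + 1) * A := mul_pos h2P hA0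
  have hK0 : 0 < K := by rw [hKdef]; linarith
  have hK42 : 42 ≤ K := by rw [hKdef]; linarith
  set K₁ : ℝ := Real.log (32 * K / (3 * c)) with hK₁def
  have hK₁0 : 0 ≤ K₁ := by
    apply Real.log_nonneg
    rw [le_div_iff₀ (by positivity)]
    linarith
  refine ⟨3 * c / 32, by positivity, 768 * (K₁ + p + 2) + 112 / (3 * c) + 7 * K₀ + 1,
    by positivity, fun s hs hσ ↦ ?_⟩
  -- the parameters at height `t = Im s`
  set t : ℝ := s.im with htdef
  set σ : ℝ := s.re with hσdef
  have ht21 : 21 ≤ |t| := by linarith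
  have ht4 : 4 ≤ |t| := by linarith
  have ht0 : 0 < |t| := by linarith
  set ℓ : ℝ := Real.log |t| with hℓdef
  have hℓ : 3 ≤ ℓ := three_le_log_of_ge ht21
  have hℓ0 : 0 < ℓ := by linarith
  have hℓ1 : 1 ≤ ℓ := by linarith
  obtain ⟨hY0, hlamY, hYℓ, -⟩ := Yv_facts hℓ
  set Y : ℝ := Yv ℓ with hYdef
  set lam : ℝ := Real.log ℓ with hlamdef
  have hlam1 : 1 ≤ lam := one_le_log hℓ
  have hlam0 : 0 < lam := by linarith
  have hY1 : 1 ≤ Y := hlam1.trans hlamY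
  obtain ⟨hR0, hR16, -, -⟩ := Rr_facts hℓ le_rfl hℓ0.le
  set R : ℝ := Rr ℓ 0 with hRdef
  have hRr : R = lam / (16 * Y) := by
    simp only [hRdef, Rr, calL, hYdef, hlamdef, zero_add]
  -- the zero-free width `w = 3c/(16Y)` at this height, and the centre `c₁ = 1 + w + it`
  set w : ℝ := 3 * c / (16 * Y) with hwdef
  have hw0 : 0 < w := by positivity
  have h8w : 8 * w ≤ R := by
    rw [hRr, hwdef]
    have h24 : 24 * c ≤ lam := by linarith
    calc 8 * (3 * c / (16 * Y)) = (24 * c) / (16 * Y) := by ring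
      _ ≤ lam / (16 * Y) := div_le_div_of_nonneg_right h24 (by positivity)
  have hwR : w ≤ R := by linarith
  have hw1 : w ≤ 1 := by linarith
  have hσw : 1 - w / 2 ≤ σ := by
    have e : (3 * c / 32) / Y = w / 2 := by rw [hwdef]; field_simp; ring
    rw [← e]; exact hσ
  set c₁ : ℂ := ((1 + w : ℝ) : ℂ) + t * I with hc₁def
  have hc₁re : c₁.re = 1 + w := by simp [hc₁def]
  have hc₁im : c₁.im = t := by simp [hc₁def]
  have hc₁1 : 1 < c₁.re := by rw [hc₁re]; linarith
  -- `|ζ| ≤ M` on `|z − c₁| ≤ 2R`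
  have htℓ : Real.log |t| ≤ ℓ + 1 := by rw [hℓdef]; linarith
  have hMdisc := norm_zeta_le_on_disc hRζ hA hB hP hℓ le_rfl hℓ0.le ht4 htℓ hw0 hwR
  set M : ℝ := Mm A B P ℓ with hMdef
  have hℓp0 : 0 < ℓ ^ p := Real.rpow_pos_of_pos hℓ0 _
  have hMeq : M = 2 ^ (P + 1) * A * ℓ ^ p + 42 * ℓ := by
    simp only [hMdef, Mm, hpdef]
  have hM0 : 0 < M := by
    rw [hMeq]
    have : 0 < 2 ^ (P + 1) * A * ℓ ^ p := mul_pos h2PA hℓp0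
    linarith
  have hM' : ∀ z ∈ closedBall c₁ (2 * R), ‖riemannZeta z‖ ≤ M := fun z hz ↦ hMdisc z hz
  -- Lemma α on the disc of radius `R`
  have hdiff : DifferentiableOn ℂ riemannZeta (ball c₁ (1 / 4)) :=
    differentiableOn_zeta_ball (by rw [hc₁im]; linarith)
  have hζc₁ : riemannZeta c₁ ≠ 0 := riemannZeta_ne_zero_of_one_le_re hc₁1.le
  obtain ⟨S, m, ψ, hS, -, -, hψ, hψb, -⟩ :=
    Literature.Analysis.Complex.titchmarsh_logDeriv_sub_sum_of_differentiableOn hdiff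
      (by linarith : 3 * R < 1 / 4) hζc₁ hR0 hM'
  -- the zeros of the Lemma-α sum lie to the left of `1 − w` (Vinogradov–Korobov)
  have hSre : ∀ a ∈ S, a.re < 1 - w := by
    intro a ha
    obtain ⟨ha0, -, haR⟩ := hS a ha
    by_contra hcon
    rw [not_lt] at hcon
    have him : |a.im - t| ≤ 1 := by
      have h := (Complex.abs_im_le_norm (a - c₁)).trans haR
      rw [Complex.sub_im, hc₁im] at h
      linarith
    exact zeta_ne_zero_of_zeroFree hc0 hcc₀ hzf hs him hcon ha0
  -- the small disc `D = {|z − c₁| < 2w}`: inside the Lemma-α range, to the right of `1 − w`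
  have hDsub : ball c₁ (2 * w) ⊆ ball c₁ R := ball_subset_ball (by linarith)
  have hDsub4 : ball c₁ (2 * w) ⊆ closedBall c₁ (R / 4) :=
    ball_subset_closedBall.trans (closedBall_subset_closedBall (by linarith))
  have hDre : ∀ z ∈ ball c₁ (2 * w), 1 - w < z.re ∧ |z.im - t| ≤ 1 := by
    intro z hz
    rw [mem_ball, dist_eq_norm] at hz
    have h1 := (Complex.abs_re_le_norm (z - c₁)).trans_lt hz
    have h2 := (Complex.abs_im_le_norm (z - c₁)).trans_lt hz
    rw [Complex.sub_re, hc₁re, abs_lt] at h1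
    rw [Complex.sub_im, hc₁im] at h2
    exact ⟨by linarith [h1.1], by linarith⟩
  have hDζ : ∀ z ∈ ball c₁ (2 * w), riemannZeta z ≠ 0 := fun z hz ↦
    zeta_ne_zero_of_zeroFree hc0 hcc₀ hzf hs (hDre z hz).2 (hDre z hz).1.le
  -- `g = −ζ′/ζ` is holomorphic on `D` with `Re g ≤ E₀` there
  set g : ℂ → ℂ := fun z ↦ -(deriv riemannZeta z / riemannZeta z) with hgdef
  have hDdiff : DifferentiableOn ℂ riemannZeta (ball c₁ (2 * w)) :=
    hdiff.mono (ball_subset_ball (by linarith))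
  have hgd : DifferentiableOn ℂ g (ball c₁ (2 * w)) :=
    ((hDdiff.deriv isOpen_ball).div hDdiff hDζ).neg
  set E₀ : ℝ := 8 * (Real.log (M / ‖riemannZeta c₁‖) + 1) / R with hE₀def
  have hMc : ‖riemannZeta c₁‖ ≤ M := hM' c₁ (mem_closedBall_self (by positivity))
  have hζpos : 0 < ‖riemannZeta c₁‖ := norm_pos_iff.2 hζc₁
  have hlog0 : 0 ≤ Real.log (M / ‖riemannZeta c₁‖) :=
    Real.log_nonneg ((one_le_div hζpos).2 hMc)
  have hE₀0 : 0 < E₀ := by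
    rw [hE₀def]
    exact div_pos (mul_pos (by norm_num) (by linarith)) hR0
  have hgre : ∀ z ∈ ball c₁ (2 * w), (g z).re ≤ E₀ := by
    intro z hz
    have hζz := hDζ z hz
    have hψz := hψ z (hDsub hz) hζz
    have hψbz := hψb z (hDsub4 hz)
    have hSz : ∀ a ∈ S, a.re < z.re := fun a ha ↦ (hSre a ha).trans (hDre z hz).1
    obtain ⟨hnonneg, -⟩ := ClassicalZFRData.re_sum_div_ge (m := m) hSz
    have e : g z = -ψ z - ∑ a ∈ S, (m a : ℂ) / (z - a) := by
      simp only [hgdef, hψz]; ring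
    rw [e, Complex.sub_re, Complex.neg_re]
    linarith [neg_le_abs (ψ z).re, Complex.abs_re_le_norm (ψ z)]
  -- `ζ(s) ≠ 0`
  have hsim : |s.im - t| ≤ 1 := by simp [htdef]
  have hsζ : riemannZeta s ≠ 0 :=
    zeta_ne_zero_of_zeroFree hc0 hcc₀ hzf hs hsim (by change 1 - w ≤ σ; linarith)
  refine ⟨hsζ, ?_⟩
  -- `|ζ′/ζ(c₁)| ≤ 1/w + K₀`
  have hgc₁ : ‖g c₁‖ ≤ 1 / w + K₀ := by
    have h := hKζ c₁ hc₁1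
    rw [hc₁re, min_eq_left (by linarith : 1 + w ≤ 2), add_sub_cancel_left] at h
    simpa only [hgdef, norm_neg] using h
  -- `E₀ ≤ 128 (K₁ + p + 2) Y`
  have hζlow : w / 2 ≤ ‖riemannZeta c₁‖ := by
    have h := ZetaClassicalRegion.norm_riemannZeta_ge_of_one_lt_re hc₁1
    rw [hc₁re] at h
    have e : (1 + w - 1) / (1 + w) = w / (1 + w) := by ring
    rw [e] at h
    have : w / 2 ≤ w / (1 + w) := div_le_div_of_nonneg_left hw0.le (by linarith) (by linarith)
    exact this.trans h
  have hlog1 : Real.log (M / ‖riemannZeta c₁‖) ≤ Real.log (2 * M / w) := by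
    refine Real.log_le_log (div_pos hM0 hζpos) ?_
    calc M / ‖riemannZeta c₁‖ ≤ M / (w / 2) := div_le_div_of_nonneg_left hM0.le (by positivity) hζlow
      _ = 2 * M / w := by rw [div_div_eq_mul_div]; ring
  have hMle : M ≤ K * ℓ ^ p := by
    have hℓp1 : ℓ ≤ ℓ ^ p := by
      calc ℓ = ℓ ^ (1 : ℝ) := (Real.rpow_one ℓ).symm
        _ ≤ ℓ ^ p := Real.rpow_le_rpow_of_exponent_le hℓ1 (by linarith)
    have h42 : 42 * ℓ ≤ 42 * ℓ ^ p := by linarith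
    rw [hMeq, hKdef, add_mul]
    linarith
  have hquot : 2 * M / w = 32 / (3 * c) * (M * Y) := by
    rw [hwdef]; field_simp; ring
  have h2Mw : 2 * M / w ≤ 32 * K / (3 * c) * ℓ ^ (p + 1) := by
    have hMY : M * Y ≤ (K * ℓ ^ p) * ℓ := mul_le_mul hMle hYℓ hY0.le (by positivity)
    rw [hquot, Real.rpow_add hℓ0, Real.rpow_one]
    calc 32 / (3 * c) * (M * Y) ≤ 32 / (3 * c) * ((K * ℓ ^ p) * ℓ) :=
          mul_le_mul_of_nonneg_left hMY (by positivity)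
      _ = 32 * K / (3 * c) * (ℓ ^ p * ℓ) := by ring
  have hlog2 : Real.log (2 * M / w) ≤ K₁ + (p + 1) * lam := by
    have hpos : 0 < 2 * M / w := by positivity
    have hne1 : (32 * K / (3 * c) : ℝ) ≠ 0 := (by positivity : (0 : ℝ) < 32 * K / (3 * c)).ne'
    have hne2 : (ℓ ^ (p + 1) : ℝ) ≠ 0 := (Real.rpow_pos_of_pos hℓ0 _).ne'
    calc Real.log (2 * M / w) ≤ Real.log (32 * K / (3 * c) * ℓ ^ (p + 1)) :=
          Real.log_le_log hpos h2Mw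
      _ = K₁ + (p + 1) * lam := by
          rw [Real.log_mul hne1 hne2, Real.log_rpow hℓ0, hK₁def, hlamdef]
  have hE₀le : E₀ ≤ 128 * (K₁ + p + 2) * Y := by
    have hnum : Real.log (M / ‖riemannZeta c₁‖) + 1 ≤ (K₁ + p + 2) * lam := by
      have hK₁lam : K₁ * 1 ≤ K₁ * lam := mul_le_mul_of_nonneg_left hlam1 hK₁0
      have e : (K₁ + p + 2) * lam = K₁ * lam + (p + 1) * lam + lam := by ring
      rw [e]
      linarith
    have hRinv : 8 / R = 128 * Y / lam := by rw [hRr]; field_simp; ring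
    calc E₀ = 8 / R * (Real.log (M / ‖riemannZeta c₁‖) + 1) := by rw [hE₀def]; ring
      _ ≤ 8 / R * ((K₁ + p + 2) * lam) := mul_le_mul_of_nonneg_left hnum (by positivity)
      _ = 128 * (K₁ + p + 2) * Y := by rw [hRinv]; field_simp
  -- the final shape of the bound
  have hYeq : Y = ℓ ^ (2 / 3 : ℝ) * lam ^ (1 / 3 : ℝ) := by rw [hYdef, Yv, ← hlamdef]
  have hCY : (768 * (K₁ + p + 2) + 112 / (3 * c) + 7 * K₀ + 1) * Y =
      768 * (K₁ + p + 2) * Y + 112 / (3 * c) * Y + 7 * K₀ * Y + Y := by ring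
  have hK₀Y : K₀ ≤ K₀ * Y := le_mul_of_one_le_right hK₀ hY1
  have hcY : 0 ≤ 112 / (3 * c) * Y := by positivity
  have hKpY : 0 ≤ 768 * (K₁ + p + 2) * Y := by positivity
  suffices hmain : ‖deriv riemannZeta s / riemannZeta s‖ ≤
      (768 * (K₁ + p + 2) + 112 / (3 * c) + 7 * K₀ + 1) * Y by
    calc ‖deriv riemannZeta s / riemannZeta s‖
        ≤ (768 * (K₁ + p + 2) + 112 / (3 * c) + 7 * K₀ + 1) * Y := hmain
      _ = (768 * (K₁ + p + 2) + 112 / (3 * c) + 7 * K₀ + 1) * ℓ ^ (2 / 3 : ℝ) *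
            lam ^ (1 / 3 : ℝ) := by rw [hYeq]; ring
  rcases le_or_gt σ (1 + 2 * w) with hcase | hcase
  · -- Case `σ ≤ 1 + 2w`: Borel–Carathéodory on `D` at `s`, `‖s − c₁‖ ≤ 3w/2`
    have hsc₁ : s - c₁ = ((σ - 1 - w : ℝ) : ℂ) := by
      apply Complex.ext
      · simp [hc₁def, hσdef]; ring
      · simp [hc₁def, htdef]
    have hns : ‖s - c₁‖ ≤ 3 * w / 2 := by
      rw [hsc₁, Complex.norm_real, Real.norm_eq_abs, abs_le]
      constructor <;> linarith
    have hsD : s ∈ ball c₁ (2 * w) := by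
      rw [mem_ball, dist_eq_norm]; linarith
    have hBC := borelCaratheodory_of_centre hE₀0 (by positivity : 0 < 2 * w) hgd hgre hsD
    have hden0 : 0 < 2 * w - ‖s - c₁‖ := by linarith
    have hn0 := norm_nonneg (s - c₁)
    have h12 : 0 ≤ 12 * w - 8 * ‖s - c₁‖ := by linarith
    have hT1 : 2 * E₀ * ‖s - c₁‖ / (2 * w - ‖s - c₁‖) ≤ 6 * E₀ := by
      rw [div_le_iff₀ hden0, ← sub_nonneg]
      have e : 6 * E₀ * (2 * w - ‖s - c₁‖) - 2 * E₀ * ‖s - c₁‖ =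
          E₀ * (12 * w - 8 * ‖s - c₁‖) := by ring
      rw [e]; exact mul_nonneg hE₀0.le h12
    have hT2 : ‖g c₁‖ * (2 * w + ‖s - c₁‖) / (2 * w - ‖s - c₁‖) ≤ 7 * ‖g c₁‖ := by
      rw [div_le_iff₀ hden0, ← sub_nonneg]
      have e : 7 * ‖g c₁‖ * (2 * w - ‖s - c₁‖) - ‖g c₁‖ * (2 * w + ‖s - c₁‖) =
          ‖g c₁‖ * (12 * w - 8 * ‖s - c₁‖) := by ring
      rw [e]; exact mul_nonneg (norm_nonneg _) h12
    have hgs : ‖g s‖ = ‖deriv riemannZeta s / riemannZeta s‖ := by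
      simp only [hgdef, norm_neg]
    have hw_inv : 1 / w = 16 / (3 * c) * Y := by rw [hwdef]; field_simp
    calc ‖deriv riemannZeta s / riemannZeta s‖ = ‖g s‖ := hgs.symm
      _ ≤ 6 * E₀ + 7 * ‖g c₁‖ := hBC.trans (add_le_add hT1 hT2)
      _ ≤ 6 * (128 * (K₁ + p + 2) * Y) + 7 * (1 / w + K₀) := by gcongr
      _ = 768 * (K₁ + p + 2) * Y + 112 / (3 * c) * Y + 7 * K₀ := by rw [hw_inv]; ring
      _ ≤ (768 * (K₁ + p + 2) + 112 / (3 * c) + 7 * K₀ + 1) * Y := by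
          rw [hCY]; linarith
  · -- Case `σ > 1 + 2w`: the trivial bound to the right of `σ = 1`
    have hs1 : 1 < s.re := by change 1 < σ; linarith
    have h := hKζ s hs1
    have hmin : 2 * w ≤ min s.re 2 - 1 := by
      change 2 * w ≤ min σ 2 - 1
      rcases le_or_gt σ 2 with h2 | h2
      · rw [min_eq_left h2]; linarith
      · rw [min_eq_right h2.le]; linarith
    have h2w : 1 / (min s.re 2 - 1) ≤ 1 / (2 * w) :=
      one_div_le_one_div_of_le (by positivity) hmin
    have hw2_inv : 1 / (2 * w) = 8 / (3 * c) * Y := by rw [hwdef]; field_simp; ring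
    calc ‖deriv riemannZeta s / riemannZeta s‖ ≤ 1 / (min s.re 2 - 1) + K₀ := h
      _ ≤ 8 / (3 * c) * Y + K₀ := by rw [← hw2_inv]; linarith
      _ ≤ (768 * (K₁ + p + 2) + 112 / (3 * c) + 7 * K₀ + 1) * Y := by
          rw [hCY]
          have : 8 / (3 * c) * Y ≤ 112 / (3 * c) * Y := by
            apply mul_le_mul_of_nonneg_right _ hY0.le
            exact div_le_div_of_nonneg_right (by norm_num) (by positivity)
          linarith


/-- **From (3.11.1) to (3.11.2)** (Titchmarsh p. 57, (3.11.6)–(3.11.8) transplanted to the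
Vinogradov–Korobov data): if `ζ ≠ 0` and `|ζ′/ζ(σ′+it)| ≤ C·Y`, `Y = (log|t|)^{2/3}(log log|t|)^{1/3}`,
for all `σ′ ≥ 1 − c/Y` (`|t| ≥ 22`), then `|1/ζ(σ+it)| ≤ 9e^{C(1/8 + c)} Y` for `σ ≥ 1 − c/Y`:
to the right of `σ₂ = 1 + 1/(8Y)` by `|1/ζ(s)| ≤ σ/(σ−1) ≤ 1 + 8Y`
(`ZetaClassicalRegion.norm_inv_le_of_re_ge`), and on `[σ, σ₂] + it` by integrating `ζ′/ζ`
(Grönwall's inequality for `u ↦ ζ(u+it)`, `‖ζ′‖ ≤ CY‖ζ‖`, over a length `≤ (1/8 + c)/Y`) down from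
`|ζ(σ₂+it)| ≥ (σ₂−1)/σ₂ ≥ 1/(9Y)`. [cite: Titchmarsh1986, Theorem 3.11 eq. (3.11.2) via (3.11.6)] -/
theorem norm_inv_zeta_le_of_logDeriv_bound {c C : ℝ} (hc : 0 < c) (hC : 0 < C)
    (h : ∀ s : ℂ, 22 ≤ |s.im| →
      1 - c / (Real.log |s.im| ^ (2 / 3 : ℝ) * Real.log (Real.log |s.im|) ^ (1 / 3 : ℝ)) ≤ s.re →
        riemannZeta s ≠ 0 ∧
        ‖deriv riemannZeta s / riemannZeta s‖ ≤
          C * Real.log |s.im| ^ (2 / 3 : ℝ) * Real.log (Real.log |s.im|) ^ (1 / 3 : ℝ))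
    {s : ℂ} (hs : 22 ≤ |s.im|)
    (hσ : 1 - c / (Real.log |s.im| ^ (2 / 3 : ℝ) * Real.log (Real.log |s.im|) ^ (1 / 3 : ℝ)) ≤
      s.re) :
    ‖(riemannZeta s)⁻¹‖ ≤ 9 * Real.exp (C * (1 / 8 + c)) *
      (Real.log |s.im| ^ (2 / 3 : ℝ) * Real.log (Real.log |s.im|) ^ (1 / 3 : ℝ)) := by
  set t : ℝ := s.im with htdef
  set σ : ℝ := s.re with hσdef
  have ht21 : 21 ≤ |t| := by linarith
  have ht0 : t ≠ 0 := by
    intro h0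
    rw [h0, abs_zero] at hs
    norm_num at hs
  set ℓ : ℝ := Real.log |t| with hℓdef
  have hℓ : 3 ≤ ℓ := three_le_log_of_ge ht21
  have hℓ0 : 0 < ℓ := by linarith
  obtain ⟨-, hlamY, -, -⟩ := Yv_facts hℓ
  set lam : ℝ := Real.log ℓ with hlamdef
  have hlam1 : 1 ≤ lam := one_le_log hℓ
  have hlam0 : 0 < lam := by linarith
  set Y : ℝ := ℓ ^ (2 / 3 : ℝ) * lam ^ (1 / 3 : ℝ) with hYdef
  have hYv : Yv ℓ = Y := by rw [hYdef, Yv, ← hlamdef]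
  have hY0 : 0 < Y := by rw [hYdef]; positivity
  have hY1 : 1 ≤ Y := hlam1.trans (hYv ▸ hlamY)
  have hexp1 : 1 ≤ Real.exp (C * (1 / 8 + c)) := Real.one_le_exp (by positivity)
  set σ₂ : ℝ := 1 + 1 / (8 * Y) with hσ₂def
  have hs_eq : (σ : ℂ) + I * t = s := by rw [mul_comm]; exact Complex.re_add_im s
  rcases le_or_gt σ₂ σ with hcase | hcase
  · -- to the right of `σ₂`: `|1/ζ| ≤ 1 + 8Y ≤ 9Y`
    have h1 := ZetaClassicalRegion.norm_inv_le_of_re_ge (s := s) (L := 8 * Y) (by positivity)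
      (by change 1 + 1 / (8 * Y) ≤ σ; exact hcase)
    calc ‖(riemannZeta s)⁻¹‖ ≤ 1 + 8 * Y := h1
      _ ≤ 9 * 1 * Y := by linarith
      _ ≤ 9 * Real.exp (C * (1 / 8 + c)) * Y := by gcongr
  · -- on `[σ, σ₂] + it`: Grönwall
    set K : ℝ := C * Y with hKdef
    have hK0 : 0 ≤ K := by positivity
    set f : ℝ → ℂ := fun u ↦ riemannZeta (u + I * t) with hfdef
    have hpt : ∀ x : ℝ, σ ≤ x → riemannZeta (x + I * t) ≠ 0 ∧
        ‖deriv riemannZeta (x + I * t)‖ ≤ K * ‖riemannZeta (x + I * t)‖ := by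
      intro x hx
      have hre : ((x : ℂ) + I * t).re = x := by simp
      have him : ((x : ℂ) + I * t).im = t := by simp
      have hx' := h ((x : ℂ) + I * t) (by rw [him]; exact hs) (by
        rw [him, hre]; exact hσ.trans hx)
      rw [him] at hx'
      obtain ⟨hζ, hbd⟩ := hx'
      have hKeq : C * Real.log |t| ^ (2 / 3 : ℝ) * Real.log (Real.log |t|) ^ (1 / 3 : ℝ) = K := by
        rw [hKdef, hYdef, hlamdef, hℓdef]; ring
      rw [hKeq] at hbd
      refine ⟨hζ, ?_⟩
      calc ‖deriv riemannZeta (x + I * t)‖ =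
          ‖deriv riemannZeta (x + I * t) / riemannZeta (x + I * t)‖ *
            ‖riemannZeta (x + I * t)‖ := by
            rw [← norm_mul, div_mul_cancel₀ _ hζ]
        _ ≤ K * ‖riemannZeta (x + I * t)‖ := mul_le_mul_of_nonneg_right hbd (norm_nonneg _)
    have hσσ₂ : σ ≤ σ₂ := hcase.le
    have hderiv : ∀ x : ℝ, HasDerivAt f (deriv riemannZeta (x + I * t)) x := fun x ↦
      ZetaOneLine.hasDerivAt_riemannZeta_horizontal ht0 x
    have hcont : ContinuousOn f (Set.Icc σ σ₂) := fun x _ ↦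
      (hderiv x).continuousAt.continuousWithinAt
    have hG := norm_le_gronwallBound_of_norm_deriv_right_le (f := f)
      (f' := fun u ↦ deriv riemannZeta (u + I * t)) (δ := ‖f σ‖) (K := K) (ε := 0) (a := σ)
      (b := σ₂) hcont (fun x _ ↦ (hderiv x).hasDerivWithinAt) le_rfl
      (fun x hx ↦ by rw [add_zero]; exact (hpt x hx.1).2)
    have hb := hG σ₂ (Set.right_mem_Icc.2 hσσ₂)
    rw [gronwallBound_ε0] at hb
    -- the exponent `K(σ₂ − σ) ≤ C(1/8 + c)`
    have hKexp : K * (σ₂ - σ) ≤ C * (1 / 8 + c) := by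
      have h1 : σ₂ - σ ≤ 1 / (8 * Y) + c / Y := by
        have : 1 - c / Y ≤ σ := hσ
        rw [hσ₂def]; linarith
      have h2 : K * (σ₂ - σ) ≤ K * (1 / (8 * Y) + c / Y) := mul_le_mul_of_nonneg_left h1 hK0
      have h3 : K * (1 / (8 * Y) + c / Y) = C * (1 / 8 + c) := by
        rw [hKdef]; field_simp
      linarith
    have hexp : Real.exp (K * (σ₂ - σ)) ≤ Real.exp (C * (1 / 8 + c)) := Real.exp_le_exp.2 hKexp
    -- lower bound at `σ₂`
    have hσ₂re : ((σ₂ : ℂ) + I * t).re = σ₂ := by simp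
    have hlow : 1 / (9 * Y) ≤ ‖f σ₂‖ := by
      have h1 : 1 < ((σ₂ : ℂ) + I * t).re := by
        rw [hσ₂re, hσ₂def]; linarith [one_div_pos.2 (by positivity : (0 : ℝ) < 8 * Y)]
      have h2 := ZetaClassicalRegion.norm_riemannZeta_ge_of_one_lt_re h1
      rw [hσ₂re] at h2
      have h3 : (σ₂ - 1) / σ₂ = 1 / (8 * Y + 1) := by
        rw [hσ₂def]; field_simp; ring
      rw [h3] at h2
      have h4 : 1 / (9 * Y) ≤ 1 / (8 * Y + 1) :=
        one_div_le_one_div_of_le (by positivity) (by linarith)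
      exact h4.trans h2
    -- combine
    have hfσ : 0 < ‖f σ‖ := norm_pos_iff.2 (hpt σ le_rfl).1
    have hmain : 1 / (9 * Y) ≤ ‖f σ‖ * Real.exp (C * (1 / 8 + c)) :=
      hlow.trans (hb.trans (mul_le_mul_of_nonneg_left hexp hfσ.le))
    have hE : 0 < Real.exp (C * (1 / 8 + c)) := Real.exp_pos _
    have hfs : f σ = riemannZeta s := by simp only [hfdef, hs_eq]
    rw [← hfs, norm_inv, inv_le_iff_one_le_mul₀ hfσ]
    rw [div_le_iff₀ (by positivity)] at hmain
    nlinarith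

/-- **Titchmarsh's Theorem 3.11, (3.11.2), at Vinogradov–Korobov strength, from a Richert-type
bound**: with `c, A, B, P` as in `norm_logDeriv_zeta_le_vk_of_richertType`, there is `C > 0` with
`|1/ζ(σ+it)| ≤ C (log|t|)^{2/3}(log log|t|)^{1/3}` for `|t| ≥ 22`,
`σ ≥ 1 − c/((log|t|)^{2/3}(log log|t|)^{1/3})`. Printed: "`1/ζ(s) = O{φ(2t+3)/θ(2t+3)}` uniformly
for `σ ≥ 1 − (A₁/4)θ(2t+3)/φ(2t+3)`". [cite: Titchmarsh1986, Theorem 3.11 eq. (3.11.2) and §6.19] -/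
theorem norm_inv_zeta_le_vk_of_richertType {A B P : ℝ} (hRζ : RichertTypeBound A B P)
    (hA : 1 ≤ A) (hB : 0 ≤ B) (hP : 0 ≤ P) :
    ∃ c : ℝ, 0 < c ∧ ∃ C : ℝ, 0 < C ∧ ∀ s : ℂ, 22 ≤ |s.im| →
      1 - c / (Real.log |s.im| ^ (2 / 3 : ℝ) * Real.log (Real.log |s.im|) ^ (1 / 3 : ℝ)) ≤ s.re →
        (riemannZeta s ≠ 0 ∧
          ‖deriv riemannZeta s / riemannZeta s‖ ≤
            C * Real.log |s.im| ^ (2 / 3 : ℝ) * Real.log (Real.log |s.im|) ^ (1 / 3 : ℝ)) ∧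
        ‖(riemannZeta s)⁻¹‖ ≤
          C * Real.log |s.im| ^ (2 / 3 : ℝ) * Real.log (Real.log |s.im|) ^ (1 / 3 : ℝ) := by
  obtain ⟨c, hc, C, hC, h⟩ := norm_logDeriv_zeta_le_vk_of_richertType hRζ hA hB hP
  refine ⟨c, hc, max C (9 * Real.exp (C * (1 / 8 + c))), lt_max_of_lt_left hC,
    fun s hs hσ ↦ ?_⟩
  have ht1 : 1 < |s.im| := by linarith
  have ha : 0 ≤ Real.log |s.im| ^ (2 / 3 : ℝ) :=
    Real.rpow_nonneg (Real.log_nonneg ht1.le) _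
  have hb : 0 ≤ Real.log (Real.log |s.im|) ^ (1 / 3 : ℝ) :=
    Real.rpow_nonneg (Real.log_nonneg (by linarith [three_le_log_of_ge (by linarith : 21 ≤ |s.im|)])) _
  obtain ⟨hζ, h1⟩ := h s hs hσ
  have h2 := norm_inv_zeta_le_of_logDeriv_bound hc hC h hs hσ
  refine ⟨⟨hζ, h1.trans ?_⟩, h2.trans ?_⟩
  · exact mul_le_mul_of_nonneg_right (mul_le_mul_of_nonneg_right (le_max_left _ _) ha) hb
  · calc 9 * Real.exp (C * (1 / 8 + c)) *
          (Real.log |s.im| ^ (2 / 3 : ℝ) * Real.log (Real.log |s.im|) ^ (1 / 3 : ℝ))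
        ≤ max C (9 * Real.exp (C * (1 / 8 + c))) *
          (Real.log |s.im| ^ (2 / 3 : ℝ) * Real.log (Real.log |s.im|) ^ (1 / 3 : ℝ)) :=
          mul_le_mul_of_nonneg_right (le_max_right _ _) (mul_nonneg ha hb)
      _ = _ := by ring

/-! ### Unconditional forms (the tree's Richert-type bound `exists_richertTypeBound_one`) -/

/-- **Titchmarsh's Theorem 3.11 with the data of §6.19, unconditionally: (3.11.1) and (3.11.2) at
Vinogradov–Korobov strength.** There are `c > 0` and `C > 0` such that for all `s = σ + it` with
`|t| ≥ 22` and `σ ≥ 1 − c/((log|t|)^{2/3}(log log|t|)^{1/3})`: `ζ(s) ≠ 0`,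
`|ζ′(s)/ζ(s)| ≤ C (log|t|)^{2/3}(log log|t|)^{1/3}` and `|1/ζ(s)| ≤ C (log|t|)^{2/3}(log log|t|)^{1/3}`.
Input: the tree's Richert-type bound `Literature.NumberTheory.LFunctions.exists_richertTypeBound_one`
(Vinogradov's exponential-sum estimate in Ivić's form, `P = 1`; standard axioms).
[cite: Titchmarsh1986, Theorem 3.11 eq. (3.11.1) and (3.11.2), §6.19] -/
theorem zeta_vk_region_bounds :
    ∃ c : ℝ, 0 < c ∧ ∃ C : ℝ, 0 < C ∧ ∀ s : ℂ, 22 ≤ |s.im| →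
      1 - c / (Real.log |s.im| ^ (2 / 3 : ℝ) * Real.log (Real.log |s.im|) ^ (1 / 3 : ℝ)) ≤ s.re →
        (riemannZeta s ≠ 0 ∧
          ‖deriv riemannZeta s / riemannZeta s‖ ≤
            C * Real.log |s.im| ^ (2 / 3 : ℝ) * Real.log (Real.log |s.im|) ^ (1 / 3 : ℝ)) ∧
        ‖(riemannZeta s)⁻¹‖ ≤
          C * Real.log |s.im| ^ (2 / 3 : ℝ) * Real.log (Real.log |s.im|) ^ (1 / 3 : ℝ) := by
  obtain ⟨A, B, hA, hB, hR⟩ := exists_richertTypeBound_one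
  exact norm_inv_zeta_le_vk_of_richertType hR hA hB (by norm_num)

/-- **(3.11.1) unconditionally**: `c > 0`, `C > 0` with `ζ(σ+it) ≠ 0` and
`|ζ′/ζ(σ+it)| ≤ C (log|t|)^{2/3}(log log|t|)^{1/3}` for `|t| ≥ 22`,
`σ ≥ 1 − c/((log|t|)^{2/3}(log log|t|)^{1/3})`. [cite: Titchmarsh1986, Theorem 3.11 eq. (3.11.1) and §6.19] -/
theorem norm_logDeriv_zeta_le_vk :
    ∃ c : ℝ, 0 < c ∧ ∃ C : ℝ, 0 < C ∧ ∀ s : ℂ, 22 ≤ |s.im| →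
      1 - c / (Real.log |s.im| ^ (2 / 3 : ℝ) * Real.log (Real.log |s.im|) ^ (1 / 3 : ℝ)) ≤ s.re →
        riemannZeta s ≠ 0 ∧
        ‖deriv riemannZeta s / riemannZeta s‖ ≤
          C * Real.log |s.im| ^ (2 / 3 : ℝ) * Real.log (Real.log |s.im|) ^ (1 / 3 : ℝ) := by
  obtain ⟨A, B, hA, hB, hR⟩ := exists_richertTypeBound_one
  exact norm_logDeriv_zeta_le_vk_of_richertType hR hA hB (by norm_num)

/-- **(3.11.2) unconditionally**: `c > 0`, `C > 0` with
`|1/ζ(σ+it)| ≤ C (log|t|)^{2/3}(log log|t|)^{1/3}` for `|t| ≥ 22`,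
`σ ≥ 1 − c/((log|t|)^{2/3}(log log|t|)^{1/3})`. [cite: Titchmarsh1986, Theorem 3.11 eq. (3.11.2) and §6.19] -/
theorem norm_inv_zeta_le_vk :
    ∃ c : ℝ, 0 < c ∧ ∃ C : ℝ, 0 < C ∧ ∀ s : ℂ, 22 ≤ |s.im| →
      1 - c / (Real.log |s.im| ^ (2 / 3 : ℝ) * Real.log (Real.log |s.im|) ^ (1 / 3 : ℝ)) ≤ s.re →
        ‖(riemannZeta s)⁻¹‖ ≤
          C * Real.log |s.im| ^ (2 / 3 : ℝ) * Real.log (Real.log |s.im|) ^ (1 / 3 : ℝ) := by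
  obtain ⟨c, hc, C, hC, h⟩ := zeta_vk_region_bounds
  exact ⟨c, hc, C, hC, fun s hs hσ ↦ (h s hs hσ).2⟩

/-- **(3.11.4) with §6.19, the printed exponent: `|ζ′(1+it)/ζ(1+it)| ≤ C (log|t|)^{2/3}(log log|t|)^{1/3}`
for `|t| ≥ 22`** (supersedes the exponent `4/3` of `norm_logDeriv_zeta_one_le` above).
[cite: Titchmarsh1986, Theorem 3.11 eq. (3.11.4) and §6.19] -/
theorem norm_logDeriv_zeta_one_le_oneThird :
    ∃ C : ℝ, 0 < C ∧ ∀ t : ℝ, 22 ≤ |t| →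
      ‖deriv riemannZeta (1 + t * I) / riemannZeta (1 + t * I)‖ ≤
        C * Real.log |t| ^ (2 / 3 : ℝ) * Real.log (Real.log |t|) ^ (1 / 3 : ℝ) := by
  obtain ⟨c, hc, C, hC, h⟩ := norm_logDeriv_zeta_le_vk
  refine ⟨C, hC, fun t ht ↦ ?_⟩
  have him : (1 + t * I : ℂ).im = t := by simp
  have hre : (1 + t * I : ℂ).re = 1 := by simp
  have hℓ : 3 ≤ Real.log |t| := three_le_log_of_ge (by linarith)
  have hden : 0 ≤ c / (Real.log |t| ^ (2 / 3 : ℝ) * Real.log (Real.log |t|) ^ (1 / 3 : ℝ)) :=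
    div_nonneg hc.le (mul_nonneg (Real.rpow_nonneg (by linarith) _)
      (Real.rpow_nonneg (by linarith [one_le_log hℓ]) _))
  have h1 := h (1 + t * I) (by rw [him]; exact ht) (by rw [him, hre]; linarith)
  rw [him] at h1
  exact h1.2

/-- **(3.11.5) with §6.19: `|1/ζ(1+it)| ≤ C (log|t|)^{2/3}(log log|t|)^{1/3}` for `|t| ≥ 22`.**
[cite: Titchmarsh1986, Theorem 3.11 eq. (3.11.5) and §6.19] -/
theorem norm_inv_zeta_one_le :
    ∃ C : ℝ, 0 < C ∧ ∀ t : ℝ, 22 ≤ |t| →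
      ‖(riemannZeta (1 + t * I))⁻¹‖ ≤
        C * Real.log |t| ^ (2 / 3 : ℝ) * Real.log (Real.log |t|) ^ (1 / 3 : ℝ) := by
  obtain ⟨c, hc, C, hC, h⟩ := norm_inv_zeta_le_vk
  refine ⟨C, hC, fun t ht ↦ ?_⟩
  have him : (1 + t * I : ℂ).im = t := by simp
  have hre : (1 + t * I : ℂ).re = 1 := by simp
  have hℓ : 3 ≤ Real.log |t| := three_le_log_of_ge (by linarith)
  have hden : 0 ≤ c / (Real.log |t| ^ (2 / 3 : ℝ) * Real.log (Real.log |t|) ^ (1 / 3 : ℝ)) :=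
    div_nonneg hc.le (mul_nonneg (Real.rpow_nonneg (by linarith) _)
      (Real.rpow_nonneg (by linarith [one_le_log hℓ]) _))
  have h1 := h (1 + t * I) (by rw [him]; exact ht) (by rw [him, hre]; linarith)
  rw [him] at h1
  exact h1

end ZetaLogDerivVK

end Literature.NumberTheory.LFunctions

end
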